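import Summits.BirchSwinnertonDyer.BirchSwinnertonDyer.Theorems.EisensteinPrimesMazurMCOnCellBKernelCertP13NoReverseEdgeII
import Summits.BirchSwinnertonDyer.BirchSwinnertonDyer.Theorems.EisensteinPrimesMazurMCOnCellBKernelCertP13NoReverseEdgeIII
import Summits.BirchSwinnertonDyer.BirchSwinnertonDyer.Theorems.EisensteinPrimesMazurMCOnCellBKernelCertP13NoReverseEdgeIV
import Literature.NumberTheory.EllipticCurves.IsogenyCompProofs
import HarnessLib

/-!
# Crux 3 `MazurMCOnCellB` (stmt-BirchSwinnertonDyer-19033) — the `p = 13` slice: THE PRICE OF 6⁷'s LEFT DOOR AT THE WHOLE CLASS of every A10-type cell at `13`, part V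
# (assembly): the door's hypothesis `h0` (a zig-zag of certified two-step edges from some `W₁ ∼ W ∼ E` to a vertex `U` with a `13`-adic Ш-unit curve `Uc ∼ U`) IMPLIES
# — granted modularity — EITHER a curve isogenous to `E` with `v₁₃(#Ш_an) = 0` (distance `0`; refuted at both displayed vertices under the readings, `no_shaUnitVertex_of_readings`)
# OR a FORWARD first edge: an imaginary quadratic `K` with `d_K ≤ −B` and `r_an(W₁ ⊗ χ_{d_K}) = 1` for some `W₁ ∼ E` — an analytic-rank-one reading at conductor `N_E·d_K² ≥ N_E·B²`.

Width seat bsd-line-x2-p1-w6 (gen 22), cell `bsd-eis` (run/shared/lean/pub/bsd-eis/), 2026-08-30; `--supports stmt-BirchSwinnertonDyer-19033 --as helper`.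
THEOREMS ONLY (no `def`, no named fact, no `sorry`, no instance). Registered line `twistback` v13b is NOT touched; nothing here closes a stub.

HOW: `h0`'s path relation steps by a forward edge or a reverse edge into a Cell-B vertex; parts I–IV (`not_twoStepAt_into_isogenous_<tag>`) exclude reverse edges into any
`W₁ ∼ E`, so (`eq_or_firstStep_forward_of_not_into`) the path is trivial — then `Uc ∼ U = W₁ ∼ E` (`IsIsogenous.trans'`) — or starts with `TwoStepAt 13 W₁ B`, whose field
`K` is Heegner for `N_{W₁} = N_E` and so has `d_K ≤ −B` (w6 g21 `…DoorPriceClassI/II.discr_le_of_heegner_isogenous_<tag>`) and carries `r_an(W₁ ⊗ χ_{d_K}) = 1` by definition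
of the edge. `B` per cell (g21, sharp by `…DoorPriceSharp`): g19 335 · A 2159 · B 599 · C 2159 · D 1095 · S 103 · I 1223 · T (#10) 199 · U (#11) 103 · V (#7) 103 · W (#9) 2159 ·
X (#12) 1167 · Y (#13) 2495; least conductor of the forward datum `N_E·B² = 9.1·10¹⁴` (S). The `h0` binder list is copied token for token from the cell files' door
`mazurMainConjectureAt_of_isIsogenous_<tag>_of_connectedClassShaUnit`.
HONEST FRAMING: a re-packaging of kernel facts (parts I–IV, g21's class-level door price) about explicit equations; CONDITIONAL on `nonempty_modularParametrizationData`
(modularity) for `N_{W₁} = N_E`; it prices the door's un-exhibited hypothesis, it does not supply it; nothing about any L-value, Selmer group, Ш, main conjecture or BSD is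
asserted or proved; closes no registered stub; 0 cells / labels / stubs / tiers move; no summit statement, no case of Mazur's main conjecture and no case of BSD is proved
for any curve. Memo `P13-NO-REVERSE-EDGE-w6g22.md` (evidence on -19033); mirror `HOME/line-x2-p1-w6-g22/`.
References: [GrossLMS1991] §1; [AtkinLehner1970] Thm. 4; [CremonaAlgorithms1997] §3.9; this lane's parts I–IV and `…DoorPriceClassI` (p766256) / `…ClassII` (p766650).
-/

set_option autoImplicit false
-- `Summit.BirchSwinnertonDyer.BirchSwinnertonDyer.…`: the summit and its single sub-problem share a name.
set_option linter.dupNamespace false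

noncomputable section

open scoped Classical
open WeierstrassCurve NumberField Literature.NumberTheory.EllipticCurves
  Literature.NumberTheory.EllipticCurves.ModularForms
  Literature.NumberTheory.QuadraticFields
  IsDedekindDomain Rat.HeightOneSpectrum
  Summit.BirchSwinnertonDyer.BirchSwinnertonDyer.Rank1Residual.X11RankOne
  Summit.BirchSwinnertonDyer.BirchSwinnertonDyer.Rank1Residual.IntModel
  Summit.BirchSwinnertonDyer.Rank1Residual
  Summit.BirchSwinnertonDyer.BirchSwinnertonDyer.Theorems
  Summit.BirchSwinnertonDyer.BirchSwinnertonDyer.Theorems.EisensteinPrimesMazurMCOnCellBTwistbackTwoStepDefs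
  Summit.BirchSwinnertonDyer.BirchSwinnertonDyer.Theorems.EisensteinPrimesMazurMCOnCellBKernelCertP13DoorPrice
  Summit.BirchSwinnertonDyer.BirchSwinnertonDyer.Theorems.EisensteinPrimesMazurMCOnCellBKernelCertP13DoorPriceSharp
  Summit.BirchSwinnertonDyer.BirchSwinnertonDyer.Theorems.EisensteinPrimesMazurMCOnCellBKernelCertP13DoorPriceClassI
  Summit.BirchSwinnertonDyer.BirchSwinnertonDyer.Theorems.EisensteinPrimesMazurMCOnCellBKernelCertP13NoReverseEdge
  Summit.BirchSwinnertonDyer.BirchSwinnertonDyer.Theorems.EisensteinPrimesMazurMCOnCellBKernelCertP13NoReverseEdgeII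
  Summit.BirchSwinnertonDyer.BirchSwinnertonDyer.Theorems.EisensteinPrimesMazurMCOnCellBKernelCertP13NoReverseEdgeIII
  Summit.BirchSwinnertonDyer.BirchSwinnertonDyer.Theorems.EisensteinPrimesMazurMCOnCellBKernelCertP13NoReverseEdgeIV

namespace Summit.BirchSwinnertonDyer.BirchSwinnertonDyer.Theorems.EisensteinPrimesMazurMCOnCellBKernelCertP13NoReverseEdgeV

/-- **Price of 6⁷'s LEFT door at the class of cell g19** (−19/13 ⊗ χ₋₄₂ (w6 g19, p745174); `N = 504452265408`, `B = 335`): granted modularity, `h0` at any `W ∼ E` forces EITHER a `Uc ∼ E` with `v₁₃(#Ш_an) = 0`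
OR a `W₁ ∼ E` and an imaginary quadratic `K` (Heegner for `N_{W₁}`, `13`; `d_K` odd, `≤ −335`) with `r_an(W₁ ⊗ χ_{d_K}) = 1` (conductor `≥ N·335²`). [cite: GrossLMS1991, §1 (p. 235)] -/
theorem leftDoor_price_e13a10 [Fact (Nat.Prime 13)] (hmod : nonempty_modularParametrizationData)
    (W : WeierstrassCurve ℚ) [W.IsElliptic] (hiso : IsIsogenous (⟨0, 0, 0, 55547317476, 58239761976082638⟩ : WeierstrassCurve ℚ) W)
    (h0 : ∃ (W₁ U Uc : WeierstrassCurve ℚ) (_ : W₁.IsElliptic) (_ : W₁.IsGloballyMinimal) (_ : U.IsElliptic)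
      (_ : U.IsGloballyMinimal) (_ : Uc.IsElliptic) (_ : Uc.IsGloballyMinimal),
      IsIsogenous W W₁ ∧
      Relation.ReflTransGen (fun A B : WeierstrassCurve ℚ ↦ TwoStepAt 13 A B ∨
        (TwoStepAt 13 B A ∧ ∃ (_ : B.IsElliptic) (_ : B.IsGloballyMinimal), X2.CellB B 13)) W₁ U ∧
      IsIsogenous U Uc ∧ ∃ q : ℚ, shaAn Uc = (q : ℂ) ∧ padicValRat 13 q = 0) :
    (∃ (Uc : WeierstrassCurve ℚ) (_ : Uc.IsElliptic) (_ : Uc.IsGloballyMinimal), IsIsogenous (⟨0, 0, 0, 55547317476, 58239761976082638⟩ : WeierstrassCurve ℚ) Uc ∧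
        ∃ q : ℚ, shaAn Uc = (q : ℂ) ∧ padicValRat 13 q = 0) ∨
      (∃ (W₁ : WeierstrassCurve ℚ) (_ : W₁.IsElliptic) (_ : W₁.IsGloballyMinimal), IsIsogenous (⟨0, 0, 0, 55547317476, 58239761976082638⟩ : WeierstrassCurve ℚ) W₁ ∧
        ∃ (K : Type) (_ : Field K) (_ : NumberField K), IsImaginaryQuadratic K ∧ NumberField.discr K ≤ -335 ∧
          SatisfiesHeegnerHypothesis (W₁.conductorNorm ℤ) K ∧ SatisfiesHeegnerHypothesis 13 K ∧ Odd (NumberField.discr K) ∧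
          (W₁.quadraticTwist (NumberField.discr K : ℚ)).analyticRank = 1) := by
  haveI := EisensteinPrimesMazurMCOnCellBKernelCertP13NoUnitVertex.isElliptic_e13a10
  obtain ⟨W₁, U, Uc, iW₁, iW₁m, iU, iUm, iUc, iUcm, hWW₁, hpath, hUUc, q, hq, hv⟩ := h0
  have hEW₁ : IsIsogenous (⟨0, 0, 0, 55547317476, 58239761976082638⟩ : WeierstrassCurve ℚ) W₁ := hiso.trans' hWW₁
  rcases eq_or_firstStep_forward_of_not_into (not_twoStepAt_into_isogenous_e13a10 hmod W₁ hEW₁) hpath with hUW | ⟨B, hWB, -⟩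
  · subst hUW
    exact Or.inl ⟨Uc, iUc, iUcm, hEW₁.trans' hUUc, q, hq, hv⟩
  · obtain ⟨_, _, _, _, K, _, _, hK, hHN, hHp, hodd, hlt, hr1, -⟩ := hWB
    exact Or.inr ⟨W₁, iW₁, iW₁m, hEW₁, K, _, _, hK, EisensteinPrimesMazurMCOnCellBKernelCertP13DoorPriceClassI.discr_le_of_heegner_isogenous_e13a10 hmod W₁ hEW₁ K hK hHN hlt, hHN, hHp, hodd, hr1⟩

/-- **Price of 6⁷'s LEFT door at the class of cell A** (−46/13 ⊗ χ₋₂₇₅₅ (w6 g20, p754117); `N = 222402912550`, `B = 2159`): granted modularity, `h0` at any `W ∼ E` forces EITHER a `Uc ∼ E` with `v₁₃(#Ш_an) = 0`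
OR a `W₁ ∼ E` and an imaginary quadratic `K` (Heegner for `N_{W₁}`, `13`; `d_K` odd, `≤ −2159`) with `r_an(W₁ ⊗ χ_{d_K}) = 1` (conductor `≥ N·2159²`). [cite: GrossLMS1991, §1 (p. 235)] -/
theorem leftDoor_price_e13a11 [Fact (Nat.Prime 13)] (hmod : nonempty_modularParametrizationData)
    (W : WeierstrassCurve ℚ) [W.IsElliptic] (hiso : IsIsogenous (⟨1, -1, 0, -593429616434692, 5637904708055929338966⟩ : WeierstrassCurve ℚ) W)
    (h0 : ∃ (W₁ U Uc : WeierstrassCurve ℚ) (_ : W₁.IsElliptic) (_ : W₁.IsGloballyMinimal) (_ : U.IsElliptic)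
      (_ : U.IsGloballyMinimal) (_ : Uc.IsElliptic) (_ : Uc.IsGloballyMinimal),
      IsIsogenous W W₁ ∧
      Relation.ReflTransGen (fun A B : WeierstrassCurve ℚ ↦ TwoStepAt 13 A B ∨
        (TwoStepAt 13 B A ∧ ∃ (_ : B.IsElliptic) (_ : B.IsGloballyMinimal), X2.CellB B 13)) W₁ U ∧
      IsIsogenous U Uc ∧ ∃ q : ℚ, shaAn Uc = (q : ℂ) ∧ padicValRat 13 q = 0) :
    (∃ (Uc : WeierstrassCurve ℚ) (_ : Uc.IsElliptic) (_ : Uc.IsGloballyMinimal), IsIsogenous (⟨1, -1, 0, -593429616434692, 5637904708055929338966⟩ : WeierstrassCurve ℚ) Uc ∧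
        ∃ q : ℚ, shaAn Uc = (q : ℂ) ∧ padicValRat 13 q = 0) ∨
      (∃ (W₁ : WeierstrassCurve ℚ) (_ : W₁.IsElliptic) (_ : W₁.IsGloballyMinimal), IsIsogenous (⟨1, -1, 0, -593429616434692, 5637904708055929338966⟩ : WeierstrassCurve ℚ) W₁ ∧
        ∃ (K : Type) (_ : Field K) (_ : NumberField K), IsImaginaryQuadratic K ∧ NumberField.discr K ≤ -2159 ∧
          SatisfiesHeegnerHypothesis (W₁.conductorNorm ℤ) K ∧ SatisfiesHeegnerHypothesis 13 K ∧ Odd (NumberField.discr K) ∧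
          (W₁.quadraticTwist (NumberField.discr K : ℚ)).analyticRank = 1) := by
  haveI := EisensteinPrimesMazurMCOnCellBKernelCertP13PredictedCell.isElliptic_e13a11
  obtain ⟨W₁, U, Uc, iW₁, iW₁m, iU, iUm, iUc, iUcm, hWW₁, hpath, hUUc, q, hq, hv⟩ := h0
  have hEW₁ : IsIsogenous (⟨1, -1, 0, -593429616434692, 5637904708055929338966⟩ : WeierstrassCurve ℚ) W₁ := hiso.trans' hWW₁
  rcases eq_or_firstStep_forward_of_not_into (not_twoStepAt_into_isogenous_e13a11 hmod W₁ hEW₁) hpath with hUW | ⟨B, hWB, -⟩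
  · subst hUW
    exact Or.inl ⟨Uc, iUc, iUcm, hEW₁.trans' hUUc, q, hq, hv⟩
  · obtain ⟨_, _, _, _, K, _, _, hK, hHN, hHp, hodd, hlt, hr1, -⟩ := hWB
    exact Or.inr ⟨W₁, iW₁, iW₁m, hEW₁, K, _, _, hK, EisensteinPrimesMazurMCOnCellBKernelCertP13DoorPriceClassI.discr_le_of_heegner_isogenous_e13a11 hmod W₁ hEW₁ K hK hHN hlt, hHN, hHp, hodd, hr1⟩

/-- **Price of 6⁷'s LEFT door at the class of cell B** (−57/13 ⊗ χ₋₁₇₄₁ (w6 g20, p756161); `N = 14374598534400`, `B = 599`): granted modularity, `h0` at any `W ∼ E` forces EITHER a `Uc ∼ E` with `v₁₃(#Ш_an) = 0`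
OR a `W₁ ∼ E` and an imaginary quadratic `K` (Heegner for `N_{W₁}`, `13`; `d_K` odd, `≤ −599`) with `r_an(W₁ ⊗ χ_{d_K}) = 1` (conductor `≥ N·599²`). [cite: GrossLMS1991, §1 (p. 235)] -/
theorem leftDoor_price_e13a12 [Fact (Nat.Prime 13)] (hmod : nonempty_modularParametrizationData)
    (W : WeierstrassCurve ℚ) [W.IsElliptic] (hiso : IsIsogenous (⟨0, 1, 0, -10265161435863023, 400579876938524794946733⟩ : WeierstrassCurve ℚ) W)
    (h0 : ∃ (W₁ U Uc : WeierstrassCurve ℚ) (_ : W₁.IsElliptic) (_ : W₁.IsGloballyMinimal) (_ : U.IsElliptic)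
      (_ : U.IsGloballyMinimal) (_ : Uc.IsElliptic) (_ : Uc.IsGloballyMinimal),
      IsIsogenous W W₁ ∧
      Relation.ReflTransGen (fun A B : WeierstrassCurve ℚ ↦ TwoStepAt 13 A B ∨
        (TwoStepAt 13 B A ∧ ∃ (_ : B.IsElliptic) (_ : B.IsGloballyMinimal), X2.CellB B 13)) W₁ U ∧
      IsIsogenous U Uc ∧ ∃ q : ℚ, shaAn Uc = (q : ℂ) ∧ padicValRat 13 q = 0) :
    (∃ (Uc : WeierstrassCurve ℚ) (_ : Uc.IsElliptic) (_ : Uc.IsGloballyMinimal), IsIsogenous (⟨0, 1, 0, -10265161435863023, 400579876938524794946733⟩ : WeierstrassCurve ℚ) Uc ∧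
        ∃ q : ℚ, shaAn Uc = (q : ℂ) ∧ padicValRat 13 q = 0) ∨
      (∃ (W₁ : WeierstrassCurve ℚ) (_ : W₁.IsElliptic) (_ : W₁.IsGloballyMinimal), IsIsogenous (⟨0, 1, 0, -10265161435863023, 400579876938524794946733⟩ : WeierstrassCurve ℚ) W₁ ∧
        ∃ (K : Type) (_ : Field K) (_ : NumberField K), IsImaginaryQuadratic K ∧ NumberField.discr K ≤ -599 ∧
          SatisfiesHeegnerHypothesis (W₁.conductorNorm ℤ) K ∧ SatisfiesHeegnerHypothesis 13 K ∧ Odd (NumberField.discr K) ∧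
          (W₁.quadraticTwist (NumberField.discr K : ℚ)).analyticRank = 1) := by
  haveI := EisensteinPrimesMazurMCOnCellBKernelCertP13ThirdCell.isElliptic_e13a12
  obtain ⟨W₁, U, Uc, iW₁, iW₁m, iU, iUm, iUc, iUcm, hWW₁, hpath, hUUc, q, hq, hv⟩ := h0
  have hEW₁ : IsIsogenous (⟨0, 1, 0, -10265161435863023, 400579876938524794946733⟩ : WeierstrassCurve ℚ) W₁ := hiso.trans' hWW₁
  rcases eq_or_firstStep_forward_of_not_into (not_twoStepAt_into_isogenous_e13a12 hmod W₁ hEW₁) hpath with hUW | ⟨B, hWB, -⟩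
  · subst hUW
    exact Or.inl ⟨Uc, iUc, iUcm, hEW₁.trans' hUUc, q, hq, hv⟩
  · obtain ⟨_, _, _, _, K, _, _, hK, hHN, hHp, hodd, hlt, hr1, -⟩ := hWB
    exact Or.inr ⟨W₁, iW₁, iW₁m, hEW₁, K, _, _, hK, EisensteinPrimesMazurMCOnCellBKernelCertP13DoorPriceClassI.discr_le_of_heegner_isogenous_e13a12 hmod W₁ hEW₁ K hK hHN hlt, hHN, hHp, hodd, hr1⟩

/-- **Price of 6⁷'s LEFT door at the class of cell C** (−46/13 ⊗ χ₋₂₂₈₉ (w6 g20, p756413); `N = 21080395378224`, `B = 2159`): granted modularity, `h0` at any `W ∼ E` forces EITHER a `Uc ∼ E` with `v₁₃(#Ш_an) = 0`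
OR a `W₁ ∼ E` and an imaginary quadratic `K` (Heegner for `N_{W₁}`, `13`; `d_K` odd, `≤ −2159`) with `r_an(W₁ ⊗ χ_{d_K}) = 1` (conductor `≥ N·2159²`). [cite: GrossLMS1991, §1 (p. 235)] -/
theorem leftDoor_price_e13a13 [Fact (Nat.Prime 13)] (hmod : nonempty_modularParametrizationData)
    (W : WeierstrassCurve ℚ) [W.IsElliptic] (hiso : IsIsogenous (⟨0, 0, 0, -6554469978333963, 206952302283565583167290⟩ : WeierstrassCurve ℚ) W)
    (h0 : ∃ (W₁ U Uc : WeierstrassCurve ℚ) (_ : W₁.IsElliptic) (_ : W₁.IsGloballyMinimal) (_ : U.IsElliptic)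
      (_ : U.IsGloballyMinimal) (_ : Uc.IsElliptic) (_ : Uc.IsGloballyMinimal),
      IsIsogenous W W₁ ∧
      Relation.ReflTransGen (fun A B : WeierstrassCurve ℚ ↦ TwoStepAt 13 A B ∨
        (TwoStepAt 13 B A ∧ ∃ (_ : B.IsElliptic) (_ : B.IsGloballyMinimal), X2.CellB B 13)) W₁ U ∧
      IsIsogenous U Uc ∧ ∃ q : ℚ, shaAn Uc = (q : ℂ) ∧ padicValRat 13 q = 0) :
    (∃ (Uc : WeierstrassCurve ℚ) (_ : Uc.IsElliptic) (_ : Uc.IsGloballyMinimal), IsIsogenous (⟨0, 0, 0, -6554469978333963, 206952302283565583167290⟩ : WeierstrassCurve ℚ) Uc ∧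
        ∃ q : ℚ, shaAn Uc = (q : ℂ) ∧ padicValRat 13 q = 0) ∨
      (∃ (W₁ : WeierstrassCurve ℚ) (_ : W₁.IsElliptic) (_ : W₁.IsGloballyMinimal), IsIsogenous (⟨0, 0, 0, -6554469978333963, 206952302283565583167290⟩ : WeierstrassCurve ℚ) W₁ ∧
        ∃ (K : Type) (_ : Field K) (_ : NumberField K), IsImaginaryQuadratic K ∧ NumberField.discr K ≤ -2159 ∧
          SatisfiesHeegnerHypothesis (W₁.conductorNorm ℤ) K ∧ SatisfiesHeegnerHypothesis 13 K ∧ Odd (NumberField.discr K) ∧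
          (W₁.quadraticTwist (NumberField.discr K : ℚ)).analyticRank = 1) := by
  haveI := EisensteinPrimesMazurMCOnCellBKernelCertP13FourthCell.isElliptic_e13a13
  obtain ⟨W₁, U, Uc, iW₁, iW₁m, iU, iUm, iUc, iUcm, hWW₁, hpath, hUUc, q, hq, hv⟩ := h0
  have hEW₁ : IsIsogenous (⟨0, 0, 0, -6554469978333963, 206952302283565583167290⟩ : WeierstrassCurve ℚ) W₁ := hiso.trans' hWW₁
  rcases eq_or_firstStep_forward_of_not_into (not_twoStepAt_into_isogenous_e13a13 hmod W₁ hEW₁) hpath with hUW | ⟨B, hWB, -⟩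
  · subst hUW
    exact Or.inl ⟨Uc, iUc, iUcm, hEW₁.trans' hUUc, q, hq, hv⟩
  · obtain ⟨_, _, _, _, K, _, _, hK, hHN, hHp, hodd, hlt, hr1, -⟩ := hWB
    exact Or.inr ⟨W₁, iW₁, iW₁m, hEW₁, K, _, _, hK, EisensteinPrimesMazurMCOnCellBKernelCertP13DoorPriceClassI.discr_le_of_heegner_isogenous_e13a13 hmod W₁ hEW₁ K hK hHN hlt, hHN, hHp, hodd, hr1⟩

/-- **Price of 6⁷'s LEFT door at the class of cell D** (−46/13 ⊗ χ₋₂₅₃₄ (w6 g20, p757375); `N = 25834519465664`, `B = 1095`): granted modularity, `h0` at any `W ∼ E` forces EITHER a `Uc ∼ E` with `v₁₃(#Ш_an) = 0`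
OR a `W₁ ∼ E` and an imaginary quadratic `K` (Heegner for `N_{W₁}`, `13`; `d_K` odd, `≤ −1095`) with `r_an(W₁ ⊗ χ_{d_K}) = 1` (conductor `≥ N·1095²`). [cite: GrossLMS1991, §1 (p. 235)] -/
theorem leftDoor_price_e13a14 [Fact (Nat.Prime 13)] (hmod : nonempty_modularParametrizationData)
    (W : WeierstrassCurve ℚ) [W.IsElliptic] (hiso : IsIsogenous (⟨0, 0, 0, -8032656845577868, 280771301908554992678640⟩ : WeierstrassCurve ℚ) W)
    (h0 : ∃ (W₁ U Uc : WeierstrassCurve ℚ) (_ : W₁.IsElliptic) (_ : W₁.IsGloballyMinimal) (_ : U.IsElliptic)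
      (_ : U.IsGloballyMinimal) (_ : Uc.IsElliptic) (_ : Uc.IsGloballyMinimal),
      IsIsogenous W W₁ ∧
      Relation.ReflTransGen (fun A B : WeierstrassCurve ℚ ↦ TwoStepAt 13 A B ∨
        (TwoStepAt 13 B A ∧ ∃ (_ : B.IsElliptic) (_ : B.IsGloballyMinimal), X2.CellB B 13)) W₁ U ∧
      IsIsogenous U Uc ∧ ∃ q : ℚ, shaAn Uc = (q : ℂ) ∧ padicValRat 13 q = 0) :
    (∃ (Uc : WeierstrassCurve ℚ) (_ : Uc.IsElliptic) (_ : Uc.IsGloballyMinimal), IsIsogenous (⟨0, 0, 0, -8032656845577868, 280771301908554992678640⟩ : WeierstrassCurve ℚ) Uc ∧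
        ∃ q : ℚ, shaAn Uc = (q : ℂ) ∧ padicValRat 13 q = 0) ∨
      (∃ (W₁ : WeierstrassCurve ℚ) (_ : W₁.IsElliptic) (_ : W₁.IsGloballyMinimal), IsIsogenous (⟨0, 0, 0, -8032656845577868, 280771301908554992678640⟩ : WeierstrassCurve ℚ) W₁ ∧
        ∃ (K : Type) (_ : Field K) (_ : NumberField K), IsImaginaryQuadratic K ∧ NumberField.discr K ≤ -1095 ∧
          SatisfiesHeegnerHypothesis (W₁.conductorNorm ℤ) K ∧ SatisfiesHeegnerHypothesis 13 K ∧ Odd (NumberField.discr K) ∧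
          (W₁.quadraticTwist (NumberField.discr K : ℚ)).analyticRank = 1) := by
  haveI := EisensteinPrimesMazurMCOnCellBKernelCertP13FifthCell.isElliptic_e13a14
  obtain ⟨W₁, U, Uc, iW₁, iW₁m, iU, iUm, iUc, iUcm, hWW₁, hpath, hUUc, q, hq, hv⟩ := h0
  have hEW₁ : IsIsogenous (⟨0, 0, 0, -8032656845577868, 280771301908554992678640⟩ : WeierstrassCurve ℚ) W₁ := hiso.trans' hWW₁
  rcases eq_or_firstStep_forward_of_not_into (not_twoStepAt_into_isogenous_e13a14 hmod W₁ hEW₁) hpath with hUW | ⟨B, hWB, -⟩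
  · subst hUW
    exact Or.inl ⟨Uc, iUc, iUcm, hEW₁.trans' hUUc, q, hq, hv⟩
  · obtain ⟨_, _, _, _, K, _, _, hK, hHN, hHp, hodd, hlt, hr1, -⟩ := hWB
    exact Or.inr ⟨W₁, iW₁, iW₁m, hEW₁, K, _, _, hK, EisensteinPrimesMazurMCOnCellBKernelCertP13DoorPriceClassI.discr_le_of_heegner_isogenous_e13a14 hmod W₁ hEW₁ K hK hHN hlt, hHN, hHp, hodd, hr1⟩

/-- **Price of 6⁷'s LEFT door at the class of cell S** (−46/13 ⊗ χ₋₁₇₁₁, 13 SPLIT (w6 g20, p757194); `N = 85782220342`, `B = 103`): granted modularity, `h0` at any `W ∼ E` forces EITHER a `Uc ∼ E` with `v₁₃(#Ш_an) = 0`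
OR a `W₁ ∼ E` and an imaginary quadratic `K` (Heegner for `N_{W₁}`, `13`; `d_K` odd, `≤ −103`) with `r_an(W₁ ⊗ χ_{d_K}) = 1` (conductor `≥ N·103²`). [cite: GrossLMS1991, §1 (p. 235)] -/
theorem leftDoor_price_e13a15 [Fact (Nat.Prime 13)] (hmod : nonempty_modularParametrizationData)
    (W : WeierstrassCurve ℚ) [W.IsElliptic] (hiso : IsIsogenous (⟨1, -1, 1, -228889583912373, 1350526023767167417979⟩ : WeierstrassCurve ℚ) W)
    (h0 : ∃ (W₁ U Uc : WeierstrassCurve ℚ) (_ : W₁.IsElliptic) (_ : W₁.IsGloballyMinimal) (_ : U.IsElliptic)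
      (_ : U.IsGloballyMinimal) (_ : Uc.IsElliptic) (_ : Uc.IsGloballyMinimal),
      IsIsogenous W W₁ ∧
      Relation.ReflTransGen (fun A B : WeierstrassCurve ℚ ↦ TwoStepAt 13 A B ∨
        (TwoStepAt 13 B A ∧ ∃ (_ : B.IsElliptic) (_ : B.IsGloballyMinimal), X2.CellB B 13)) W₁ U ∧
      IsIsogenous U Uc ∧ ∃ q : ℚ, shaAn Uc = (q : ℂ) ∧ padicValRat 13 q = 0) :
    (∃ (Uc : WeierstrassCurve ℚ) (_ : Uc.IsElliptic) (_ : Uc.IsGloballyMinimal), IsIsogenous (⟨1, -1, 1, -228889583912373, 1350526023767167417979⟩ : WeierstrassCurve ℚ) Uc ∧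
        ∃ q : ℚ, shaAn Uc = (q : ℂ) ∧ padicValRat 13 q = 0) ∨
      (∃ (W₁ : WeierstrassCurve ℚ) (_ : W₁.IsElliptic) (_ : W₁.IsGloballyMinimal), IsIsogenous (⟨1, -1, 1, -228889583912373, 1350526023767167417979⟩ : WeierstrassCurve ℚ) W₁ ∧
        ∃ (K : Type) (_ : Field K) (_ : NumberField K), IsImaginaryQuadratic K ∧ NumberField.discr K ≤ -103 ∧
          SatisfiesHeegnerHypothesis (W₁.conductorNorm ℤ) K ∧ SatisfiesHeegnerHypothesis 13 K ∧ Odd (NumberField.discr K) ∧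
          (W₁.quadraticTwist (NumberField.discr K : ℚ)).analyticRank = 1) := by
  haveI := EisensteinPrimesMazurMCOnCellBKernelCertP13SplitA10Cell.isElliptic_e13a15
  obtain ⟨W₁, U, Uc, iW₁, iW₁m, iU, iUm, iUc, iUcm, hWW₁, hpath, hUUc, q, hq, hv⟩ := h0
  have hEW₁ : IsIsogenous (⟨1, -1, 1, -228889583912373, 1350526023767167417979⟩ : WeierstrassCurve ℚ) W₁ := hiso.trans' hWW₁
  rcases eq_or_firstStep_forward_of_not_into (not_twoStepAt_into_isogenous_e13a15 hmod W₁ hEW₁) hpath with hUW | ⟨B, hWB, -⟩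
  · subst hUW
    exact Or.inl ⟨Uc, iUc, iUcm, hEW₁.trans' hUUc, q, hq, hv⟩
  · obtain ⟨_, _, _, _, K, _, _, hK, hHN, hHp, hodd, hlt, hr1, -⟩ := hWB
    exact Or.inr ⟨W₁, iW₁, iW₁m, hEW₁, K, _, _, hK, EisensteinPrimesMazurMCOnCellBKernelCertP13DoorPriceClassI.discr_le_of_heegner_isogenous_e13a15 hmod W₁ hEW₁ K hK hHN hlt, hHN, hHp, hodd, hr1⟩

/-- **Price of 6⁷'s LEFT door at the class of cell I** (−32/13 ⊗ χ₋₁₄₇₉ (w6 g20, p759720); `N = 74042484789546`, `B = 1223`): granted modularity, `h0` at any `W ∼ E` forces EITHER a `Uc ∼ E` with `v₁₃(#Ш_an) = 0`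
OR a `W₁ ∼ E` and an imaginary quadratic `K` (Heegner for `N_{W₁}`, `13`; `d_K` odd, `≤ −1223`) with `r_an(W₁ ⊗ χ_{d_K}) = 1` (conductor `≥ N·1223²`). [cite: GrossLMS1991, §1 (p. 235)] -/
theorem leftDoor_price_e13a16 [Fact (Nat.Prime 13)] (hmod : nonempty_modularParametrizationData)
    (W : WeierstrassCurve ℚ) [W.IsElliptic] (hiso : IsIsogenous (⟨1, -1, 1, -332636942380889, 3592856931198596701273⟩ : WeierstrassCurve ℚ) W)
    (h0 : ∃ (W₁ U Uc : WeierstrassCurve ℚ) (_ : W₁.IsElliptic) (_ : W₁.IsGloballyMinimal) (_ : U.IsElliptic)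
      (_ : U.IsGloballyMinimal) (_ : Uc.IsElliptic) (_ : Uc.IsGloballyMinimal),
      IsIsogenous W W₁ ∧
      Relation.ReflTransGen (fun A B : WeierstrassCurve ℚ ↦ TwoStepAt 13 A B ∨
        (TwoStepAt 13 B A ∧ ∃ (_ : B.IsElliptic) (_ : B.IsGloballyMinimal), X2.CellB B 13)) W₁ U ∧
      IsIsogenous U Uc ∧ ∃ q : ℚ, shaAn Uc = (q : ℂ) ∧ padicValRat 13 q = 0) :
    (∃ (Uc : WeierstrassCurve ℚ) (_ : Uc.IsElliptic) (_ : Uc.IsGloballyMinimal), IsIsogenous (⟨1, -1, 1, -332636942380889, 3592856931198596701273⟩ : WeierstrassCurve ℚ) Uc ∧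
        ∃ q : ℚ, shaAn Uc = (q : ℂ) ∧ padicValRat 13 q = 0) ∨
      (∃ (W₁ : WeierstrassCurve ℚ) (_ : W₁.IsElliptic) (_ : W₁.IsGloballyMinimal), IsIsogenous (⟨1, -1, 1, -332636942380889, 3592856931198596701273⟩ : WeierstrassCurve ℚ) W₁ ∧
        ∃ (K : Type) (_ : Field K) (_ : NumberField K), IsImaginaryQuadratic K ∧ NumberField.discr K ≤ -1223 ∧
          SatisfiesHeegnerHypothesis (W₁.conductorNorm ℤ) K ∧ SatisfiesHeegnerHypothesis 13 K ∧ Odd (NumberField.discr K) ∧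
          (W₁.quadraticTwist (NumberField.discr K : ℚ)).analyticRank = 1) := by
  haveI := EisensteinPrimesMazurMCOnCellBKernelCertP13InertCell.isElliptic_e13a16
  obtain ⟨W₁, U, Uc, iW₁, iW₁m, iU, iUm, iUc, iUcm, hWW₁, hpath, hUUc, q, hq, hv⟩ := h0
  have hEW₁ : IsIsogenous (⟨1, -1, 1, -332636942380889, 3592856931198596701273⟩ : WeierstrassCurve ℚ) W₁ := hiso.trans' hWW₁
  rcases eq_or_firstStep_forward_of_not_into (not_twoStepAt_into_isogenous_e13a16 hmod W₁ hEW₁) hpath with hUW | ⟨B, hWB, -⟩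
  · subst hUW
    exact Or.inl ⟨Uc, iUc, iUcm, hEW₁.trans' hUUc, q, hq, hv⟩
  · obtain ⟨_, _, _, _, K, _, _, hK, hHN, hHp, hodd, hlt, hr1, -⟩ := hWB
    exact Or.inr ⟨W₁, iW₁, iW₁m, hEW₁, K, _, _, hK, EisensteinPrimesMazurMCOnCellBKernelCertP13DoorPriceClassI.discr_le_of_heegner_isogenous_e13a16 hmod W₁ hEW₁ K hK hHN hlt, hHN, hHp, hodd, hr1⟩

/-- **Price of 6⁷'s LEFT door at the class of cell T** (−46/13 ⊗ χ₋₆₈₁₅ (A10 #10, w6 g21); `N = 1360908680950`, `B = 199`): granted modularity, `h0` at any `W ∼ E` forces EITHER a `Uc ∼ E` with `v₁₃(#Ш_an) = 0`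
OR a `W₁ ∼ E` and an imaginary quadratic `K` (Heegner for `N_{W₁}`, `13`; `d_K` odd, `≤ −199`) with `r_an(W₁ ⊗ χ_{d_K}) = 1` (conductor `≥ N·199²`). [cite: GrossLMS1991, §1 (p. 235)] -/
theorem leftDoor_price_e13a17 [Fact (Nat.Prime 13)] (hmod : nonempty_modularParametrizationData)
    (W : WeierstrassCurve ℚ) [W.IsElliptic] (hiso : IsIsogenous (⟨1, -1, 1, -3631263220787355, 85339578849437030591897⟩ : WeierstrassCurve ℚ) W)
    (h0 : ∃ (W₁ U Uc : WeierstrassCurve ℚ) (_ : W₁.IsElliptic) (_ : W₁.IsGloballyMinimal) (_ : U.IsElliptic)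
      (_ : U.IsGloballyMinimal) (_ : Uc.IsElliptic) (_ : Uc.IsGloballyMinimal),
      IsIsogenous W W₁ ∧
      Relation.ReflTransGen (fun A B : WeierstrassCurve ℚ ↦ TwoStepAt 13 A B ∨
        (TwoStepAt 13 B A ∧ ∃ (_ : B.IsElliptic) (_ : B.IsGloballyMinimal), X2.CellB B 13)) W₁ U ∧
      IsIsogenous U Uc ∧ ∃ q : ℚ, shaAn Uc = (q : ℂ) ∧ padicValRat 13 q = 0) :
    (∃ (Uc : WeierstrassCurve ℚ) (_ : Uc.IsElliptic) (_ : Uc.IsGloballyMinimal), IsIsogenous (⟨1, -1, 1, -3631263220787355, 85339578849437030591897⟩ : WeierstrassCurve ℚ) Uc ∧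
        ∃ q : ℚ, shaAn Uc = (q : ℂ) ∧ padicValRat 13 q = 0) ∨
      (∃ (W₁ : WeierstrassCurve ℚ) (_ : W₁.IsElliptic) (_ : W₁.IsGloballyMinimal), IsIsogenous (⟨1, -1, 1, -3631263220787355, 85339578849437030591897⟩ : WeierstrassCurve ℚ) W₁ ∧
        ∃ (K : Type) (_ : Field K) (_ : NumberField K), IsImaginaryQuadratic K ∧ NumberField.discr K ≤ -199 ∧
          SatisfiesHeegnerHypothesis (W₁.conductorNorm ℤ) K ∧ SatisfiesHeegnerHypothesis 13 K ∧ Odd (NumberField.discr K) ∧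
          (W₁.quadraticTwist (NumberField.discr K : ℚ)).analyticRank = 1) := by
  haveI := EisensteinPrimesMazurMCOnCellBKernelCertP13TenthCell.isElliptic_e13a17
  obtain ⟨W₁, U, Uc, iW₁, iW₁m, iU, iUm, iUc, iUcm, hWW₁, hpath, hUUc, q, hq, hv⟩ := h0
  have hEW₁ : IsIsogenous (⟨1, -1, 1, -3631263220787355, 85339578849437030591897⟩ : WeierstrassCurve ℚ) W₁ := hiso.trans' hWW₁
  rcases eq_or_firstStep_forward_of_not_into (not_twoStepAt_into_isogenous_e13a17 hmod W₁ hEW₁) hpath with hUW | ⟨B, hWB, -⟩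
  · subst hUW
    exact Or.inl ⟨Uc, iUc, iUcm, hEW₁.trans' hUUc, q, hq, hv⟩
  · obtain ⟨_, _, _, _, K, _, _, hK, hHN, hHp, hodd, hlt, hr1, -⟩ := hWB
    exact Or.inr ⟨W₁, iW₁, iW₁m, hEW₁, K, _, _, hK, EisensteinPrimesMazurMCOnCellBKernelCertP13DoorPriceClassII.discr_le_of_heegner_isogenous_e13a17 hmod W₁ hEW₁ K hK hHN hlt, hHN, hHp, hodd, hr1⟩

/-- **Price of 6⁷'s LEFT door at the class of cell U** (−46/13 ⊗ χ₋₄₅₀₁ (A10 #11, Ш_an = 13²·3², w6 g21); `N = 81508930119344`, `B = 103`): granted modularity, `h0` at any `W ∼ E` forces EITHER a `Uc ∼ E` with `v₁₃(#Ш_an) = 0`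
OR a `W₁ ∼ E` and an imaginary quadratic `K` (Heegner for `N_{W₁}`, `13`; `d_K` odd, `≤ −103`) with `r_an(W₁ ⊗ χ_{d_K}) = 1` (conductor `≥ N·103²`). [cite: GrossLMS1991, §1 (p. 235)] -/
theorem leftDoor_price_e13a18 [Fact (Nat.Prime 13)] (hmod : nonempty_modularParametrizationData)
    (W : WeierstrassCurve ℚ) [W.IsElliptic] (hiso : IsIsogenous (⟨0, 0, 0, -25343349868344403, 1573475274969726091051410⟩ : WeierstrassCurve ℚ) W)
    (h0 : ∃ (W₁ U Uc : WeierstrassCurve ℚ) (_ : W₁.IsElliptic) (_ : W₁.IsGloballyMinimal) (_ : U.IsElliptic)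
      (_ : U.IsGloballyMinimal) (_ : Uc.IsElliptic) (_ : Uc.IsGloballyMinimal),
      IsIsogenous W W₁ ∧
      Relation.ReflTransGen (fun A B : WeierstrassCurve ℚ ↦ TwoStepAt 13 A B ∨
        (TwoStepAt 13 B A ∧ ∃ (_ : B.IsElliptic) (_ : B.IsGloballyMinimal), X2.CellB B 13)) W₁ U ∧
      IsIsogenous U Uc ∧ ∃ q : ℚ, shaAn Uc = (q : ℂ) ∧ padicValRat 13 q = 0) :
    (∃ (Uc : WeierstrassCurve ℚ) (_ : Uc.IsElliptic) (_ : Uc.IsGloballyMinimal), IsIsogenous (⟨0, 0, 0, -25343349868344403, 1573475274969726091051410⟩ : WeierstrassCurve ℚ) Uc ∧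
        ∃ q : ℚ, shaAn Uc = (q : ℂ) ∧ padicValRat 13 q = 0) ∨
      (∃ (W₁ : WeierstrassCurve ℚ) (_ : W₁.IsElliptic) (_ : W₁.IsGloballyMinimal), IsIsogenous (⟨0, 0, 0, -25343349868344403, 1573475274969726091051410⟩ : WeierstrassCurve ℚ) W₁ ∧
        ∃ (K : Type) (_ : Field K) (_ : NumberField K), IsImaginaryQuadratic K ∧ NumberField.discr K ≤ -103 ∧
          SatisfiesHeegnerHypothesis (W₁.conductorNorm ℤ) K ∧ SatisfiesHeegnerHypothesis 13 K ∧ Odd (NumberField.discr K) ∧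
          (W₁.quadraticTwist (NumberField.discr K : ℚ)).analyticRank = 1) := by
  haveI := EisensteinPrimesMazurMCOnCellBKernelCertP13EleventhCell.isElliptic_e13a18
  obtain ⟨W₁, U, Uc, iW₁, iW₁m, iU, iUm, iUc, iUcm, hWW₁, hpath, hUUc, q, hq, hv⟩ := h0
  have hEW₁ : IsIsogenous (⟨0, 0, 0, -25343349868344403, 1573475274969726091051410⟩ : WeierstrassCurve ℚ) W₁ := hiso.trans' hWW₁
  rcases eq_or_firstStep_forward_of_not_into (not_twoStepAt_into_isogenous_e13a18 hmod W₁ hEW₁) hpath with hUW | ⟨B, hWB, -⟩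
  · subst hUW
    exact Or.inl ⟨Uc, iUc, iUcm, hEW₁.trans' hUUc, q, hq, hv⟩
  · obtain ⟨_, _, _, _, K, _, _, hK, hHN, hHp, hodd, hlt, hr1, -⟩ := hWB
    exact Or.inr ⟨W₁, iW₁, iW₁m, hEW₁, K, _, _, hK, EisensteinPrimesMazurMCOnCellBKernelCertP13DoorPriceClassII.discr_le_of_heegner_isogenous_e13a18 hmod W₁ hEW₁ K hK hHN hlt, hHN, hHp, hodd, hr1⟩

/-- **Price of 6⁷'s LEFT door at the class of cell V** (−46/13 ⊗ χ₋₁₅₈₃ (g20 #7, file w6 g21); `N = 61752577520998`, `B = 103`): granted modularity, `h0` at any `W ∼ E` forces EITHER a `Uc ∼ E` with `v₁₃(#Ш_an) = 0`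
OR a `W₁ ∼ E` and an imaginary quadratic `K` (Heegner for `N_{W₁}`, `13`; `d_K` odd, `≤ −103`) with `r_an(W₁ ⊗ χ_{d_K}) = 1` (conductor `≥ N·103²`). [cite: GrossLMS1991, §1 (p. 235)] -/
theorem leftDoor_price_e13a19 [Fact (Nat.Prime 13)] (hmod : nonempty_modularParametrizationData)
    (W : WeierstrassCurve ℚ) [W.IsElliptic] (hiso : IsIsogenous (⟨1, -1, 1, -195924090908517, 1069536658430224254155⟩ : WeierstrassCurve ℚ) W)
    (h0 : ∃ (W₁ U Uc : WeierstrassCurve ℚ) (_ : W₁.IsElliptic) (_ : W₁.IsGloballyMinimal) (_ : U.IsElliptic)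
      (_ : U.IsGloballyMinimal) (_ : Uc.IsElliptic) (_ : Uc.IsGloballyMinimal),
      IsIsogenous W W₁ ∧
      Relation.ReflTransGen (fun A B : WeierstrassCurve ℚ ↦ TwoStepAt 13 A B ∨
        (TwoStepAt 13 B A ∧ ∃ (_ : B.IsElliptic) (_ : B.IsGloballyMinimal), X2.CellB B 13)) W₁ U ∧
      IsIsogenous U Uc ∧ ∃ q : ℚ, shaAn Uc = (q : ℂ) ∧ padicValRat 13 q = 0) :
    (∃ (Uc : WeierstrassCurve ℚ) (_ : Uc.IsElliptic) (_ : Uc.IsGloballyMinimal), IsIsogenous (⟨1, -1, 1, -195924090908517, 1069536658430224254155⟩ : WeierstrassCurve ℚ) Uc ∧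
        ∃ q : ℚ, shaAn Uc = (q : ℂ) ∧ padicValRat 13 q = 0) ∨
      (∃ (W₁ : WeierstrassCurve ℚ) (_ : W₁.IsElliptic) (_ : W₁.IsGloballyMinimal), IsIsogenous (⟨1, -1, 1, -195924090908517, 1069536658430224254155⟩ : WeierstrassCurve ℚ) W₁ ∧
        ∃ (K : Type) (_ : Field K) (_ : NumberField K), IsImaginaryQuadratic K ∧ NumberField.discr K ≤ -103 ∧
          SatisfiesHeegnerHypothesis (W₁.conductorNorm ℤ) K ∧ SatisfiesHeegnerHypothesis 13 K ∧ Odd (NumberField.discr K) ∧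
          (W₁.quadraticTwist (NumberField.discr K : ℚ)).analyticRank = 1) := by
  haveI := EisensteinPrimesMazurMCOnCellBKernelCertP13SeventhCell.isElliptic_e13a19
  obtain ⟨W₁, U, Uc, iW₁, iW₁m, iU, iUm, iUc, iUcm, hWW₁, hpath, hUUc, q, hq, hv⟩ := h0
  have hEW₁ : IsIsogenous (⟨1, -1, 1, -195924090908517, 1069536658430224254155⟩ : WeierstrassCurve ℚ) W₁ := hiso.trans' hWW₁
  rcases eq_or_firstStep_forward_of_not_into (not_twoStepAt_into_isogenous_e13a19 hmod W₁ hEW₁) hpath with hUW | ⟨B, hWB, -⟩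
  · subst hUW
    exact Or.inl ⟨Uc, iUc, iUcm, hEW₁.trans' hUUc, q, hq, hv⟩
  · obtain ⟨_, _, _, _, K, _, _, hK, hHN, hHp, hodd, hlt, hr1, -⟩ := hWB
    exact Or.inr ⟨W₁, iW₁, iW₁m, hEW₁, K, _, _, hK, EisensteinPrimesMazurMCOnCellBKernelCertP13DoorPriceClassII.discr_le_of_heegner_isogenous_e13a19 hmod W₁ hEW₁ K hK hHN hlt, hHN, hHp, hodd, hr1⟩

/-- **Price of 6⁷'s LEFT door at the class of cell W** (−46/13 ⊗ χ₋₂₆₇₉ (g20 #9, file w6 g21); `N = 176863692176262`, `B = 2159`): granted modularity, `h0` at any `W ∼ E` forces EITHER a `Uc ∼ E` with `v₁₃(#Ш_an) = 0`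
OR a `W₁ ∼ E` and an imaginary quadratic `K` (Heegner for `N_{W₁}`, `13`; `d_K` odd, `≤ −2159`) with `r_an(W₁ ⊗ χ_{d_K}) = 1` (conductor `≥ N·2159²`). [cite: GrossLMS1991, §1 (p. 235)] -/
theorem leftDoor_price_e13a20 [Fact (Nat.Prime 13)] (hmod : nonempty_modularParametrizationData)
    (W : WeierstrassCurve ℚ) [W.IsElliptic] (hiso : IsIsogenous (⟨1, -1, 1, -561140271312158, 5184072454112665382539⟩ : WeierstrassCurve ℚ) W)
    (h0 : ∃ (W₁ U Uc : WeierstrassCurve ℚ) (_ : W₁.IsElliptic) (_ : W₁.IsGloballyMinimal) (_ : U.IsElliptic)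
      (_ : U.IsGloballyMinimal) (_ : Uc.IsElliptic) (_ : Uc.IsGloballyMinimal),
      IsIsogenous W W₁ ∧
      Relation.ReflTransGen (fun A B : WeierstrassCurve ℚ ↦ TwoStepAt 13 A B ∨
        (TwoStepAt 13 B A ∧ ∃ (_ : B.IsElliptic) (_ : B.IsGloballyMinimal), X2.CellB B 13)) W₁ U ∧
      IsIsogenous U Uc ∧ ∃ q : ℚ, shaAn Uc = (q : ℂ) ∧ padicValRat 13 q = 0) :
    (∃ (Uc : WeierstrassCurve ℚ) (_ : Uc.IsElliptic) (_ : Uc.IsGloballyMinimal), IsIsogenous (⟨1, -1, 1, -561140271312158, 5184072454112665382539⟩ : WeierstrassCurve ℚ) Uc ∧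
        ∃ q : ℚ, shaAn Uc = (q : ℂ) ∧ padicValRat 13 q = 0) ∨
      (∃ (W₁ : WeierstrassCurve ℚ) (_ : W₁.IsElliptic) (_ : W₁.IsGloballyMinimal), IsIsogenous (⟨1, -1, 1, -561140271312158, 5184072454112665382539⟩ : WeierstrassCurve ℚ) W₁ ∧
        ∃ (K : Type) (_ : Field K) (_ : NumberField K), IsImaginaryQuadratic K ∧ NumberField.discr K ≤ -2159 ∧
          SatisfiesHeegnerHypothesis (W₁.conductorNorm ℤ) K ∧ SatisfiesHeegnerHypothesis 13 K ∧ Odd (NumberField.discr K) ∧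
          (W₁.quadraticTwist (NumberField.discr K : ℚ)).analyticRank = 1) := by
  haveI := EisensteinPrimesMazurMCOnCellBKernelCertP13NinthCell.isElliptic_e13a20
  obtain ⟨W₁, U, Uc, iW₁, iW₁m, iU, iUm, iUc, iUcm, hWW₁, hpath, hUUc, q, hq, hv⟩ := h0
  have hEW₁ : IsIsogenous (⟨1, -1, 1, -561140271312158, 5184072454112665382539⟩ : WeierstrassCurve ℚ) W₁ := hiso.trans' hWW₁
  rcases eq_or_firstStep_forward_of_not_into (not_twoStepAt_into_isogenous_e13a20 hmod W₁ hEW₁) hpath with hUW | ⟨B, hWB, -⟩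
  · subst hUW
    exact Or.inl ⟨Uc, iUc, iUcm, hEW₁.trans' hUUc, q, hq, hv⟩
  · obtain ⟨_, _, _, _, K, _, _, hK, hHN, hHp, hodd, hlt, hr1, -⟩ := hWB
    exact Or.inr ⟨W₁, iW₁, iW₁m, hEW₁, K, _, _, hK, EisensteinPrimesMazurMCOnCellBKernelCertP13DoorPriceClassII.discr_le_of_heegner_isogenous_e13a20 hmod W₁ hEW₁ K hK hHN hlt, hHN, hHp, hodd, hr1⟩

/-- **Price of 6⁷'s LEFT door at the class of cell X** (−46/13 ⊗ χ₋₃₉₆₂ (A10 #12, w6 g21); `N = 63156217132736`, `B = 1167`): granted modularity, `h0` at any `W ∼ E` forces EITHER a `Uc ∼ E` with `v₁₃(#Ш_an) = 0`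
OR a `W₁ ∼ E` and an imaginary quadratic `K` (Heegner for `N_{W₁}`, `13`; `d_K` odd, `≤ −1167`) with `r_an(W₁ ⊗ χ_{d_K}) = 1` (conductor `≥ N·1167²`). [cite: GrossLMS1991, §1 (p. 235)] -/
theorem leftDoor_price_e13a21 [Fact (Nat.Prime 13)] (hmod : nonempty_modularParametrizationData)
    (W : WeierstrassCurve ℚ) [W.IsElliptic] (hiso : IsIsogenous (⟨0, 0, 0, -19636990754417932, 1073189210454698748030480⟩ : WeierstrassCurve ℚ) W)
    (h0 : ∃ (W₁ U Uc : WeierstrassCurve ℚ) (_ : W₁.IsElliptic) (_ : W₁.IsGloballyMinimal) (_ : U.IsElliptic)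
      (_ : U.IsGloballyMinimal) (_ : Uc.IsElliptic) (_ : Uc.IsGloballyMinimal),
      IsIsogenous W W₁ ∧
      Relation.ReflTransGen (fun A B : WeierstrassCurve ℚ ↦ TwoStepAt 13 A B ∨
        (TwoStepAt 13 B A ∧ ∃ (_ : B.IsElliptic) (_ : B.IsGloballyMinimal), X2.CellB B 13)) W₁ U ∧
      IsIsogenous U Uc ∧ ∃ q : ℚ, shaAn Uc = (q : ℂ) ∧ padicValRat 13 q = 0) :
    (∃ (Uc : WeierstrassCurve ℚ) (_ : Uc.IsElliptic) (_ : Uc.IsGloballyMinimal), IsIsogenous (⟨0, 0, 0, -19636990754417932, 1073189210454698748030480⟩ : WeierstrassCurve ℚ) Uc ∧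
        ∃ q : ℚ, shaAn Uc = (q : ℂ) ∧ padicValRat 13 q = 0) ∨
      (∃ (W₁ : WeierstrassCurve ℚ) (_ : W₁.IsElliptic) (_ : W₁.IsGloballyMinimal), IsIsogenous (⟨0, 0, 0, -19636990754417932, 1073189210454698748030480⟩ : WeierstrassCurve ℚ) W₁ ∧
        ∃ (K : Type) (_ : Field K) (_ : NumberField K), IsImaginaryQuadratic K ∧ NumberField.discr K ≤ -1167 ∧
          SatisfiesHeegnerHypothesis (W₁.conductorNorm ℤ) K ∧ SatisfiesHeegnerHypothesis 13 K ∧ Odd (NumberField.discr K) ∧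
          (W₁.quadraticTwist (NumberField.discr K : ℚ)).analyticRank = 1) := by
  haveI := EisensteinPrimesMazurMCOnCellBKernelCertP13TwelfthCell.isElliptic_e13a21
  obtain ⟨W₁, U, Uc, iW₁, iW₁m, iU, iUm, iUc, iUcm, hWW₁, hpath, hUUc, q, hq, hv⟩ := h0
  have hEW₁ : IsIsogenous (⟨0, 0, 0, -19636990754417932, 1073189210454698748030480⟩ : WeierstrassCurve ℚ) W₁ := hiso.trans' hWW₁
  rcases eq_or_firstStep_forward_of_not_into (not_twoStepAt_into_isogenous_e13a21 hmod W₁ hEW₁) hpath with hUW | ⟨B, hWB, -⟩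
  · subst hUW
    exact Or.inl ⟨Uc, iUc, iUcm, hEW₁.trans' hUUc, q, hq, hv⟩
  · obtain ⟨_, _, _, _, K, _, _, hK, hHN, hHp, hodd, hlt, hr1, -⟩ := hWB
    exact Or.inr ⟨W₁, iW₁, iW₁m, hEW₁, K, _, _, hK, EisensteinPrimesMazurMCOnCellBKernelCertP13DoorPriceClassII.discr_le_of_heegner_isogenous_e13a21 hmod W₁ hEW₁ K hK hHN hlt, hHN, hHp, hodd, hr1⟩

/-- **Price of 6⁷'s LEFT door at the class of cell Y** (−46/13 ⊗ χ₋₉₈₃₁ (A10 #13, w6 g21); `N = 2831996134422`, `B = 2495`): granted modularity, `h0` at any `W ∼ E` forces EITHER a `Uc ∼ E` with `v₁₃(#Ш_an) = 0`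
OR a `W₁ ∼ E` and an imaginary quadratic `K` (Heegner for `N_{W₁}`, `13`; `d_K` odd, `≤ −2495`) with `r_an(W₁ ⊗ χ_{d_K}) = 1` (conductor `≥ N·2495²`). [cite: GrossLMS1991, §1 (p. 235)] -/
theorem leftDoor_price_e13a22 [Fact (Nat.Prime 13)] (hmod : nonempty_modularParametrizationData)
    (W : WeierstrassCurve ℚ) [W.IsElliptic] (hiso : IsIsogenous (⟨1, -1, 1, -7556512459866068, 256180460309112042534709⟩ : WeierstrassCurve ℚ) W)
    (h0 : ∃ (W₁ U Uc : WeierstrassCurve ℚ) (_ : W₁.IsElliptic) (_ : W₁.IsGloballyMinimal) (_ : U.IsElliptic)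
      (_ : U.IsGloballyMinimal) (_ : Uc.IsElliptic) (_ : Uc.IsGloballyMinimal),
      IsIsogenous W W₁ ∧
      Relation.ReflTransGen (fun A B : WeierstrassCurve ℚ ↦ TwoStepAt 13 A B ∨
        (TwoStepAt 13 B A ∧ ∃ (_ : B.IsElliptic) (_ : B.IsGloballyMinimal), X2.CellB B 13)) W₁ U ∧
      IsIsogenous U Uc ∧ ∃ q : ℚ, shaAn Uc = (q : ℂ) ∧ padicValRat 13 q = 0) :
    (∃ (Uc : WeierstrassCurve ℚ) (_ : Uc.IsElliptic) (_ : Uc.IsGloballyMinimal), IsIsogenous (⟨1, -1, 1, -7556512459866068, 256180460309112042534709⟩ : WeierstrassCurve ℚ) Uc ∧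
        ∃ q : ℚ, shaAn Uc = (q : ℂ) ∧ padicValRat 13 q = 0) ∨
      (∃ (W₁ : WeierstrassCurve ℚ) (_ : W₁.IsElliptic) (_ : W₁.IsGloballyMinimal), IsIsogenous (⟨1, -1, 1, -7556512459866068, 256180460309112042534709⟩ : WeierstrassCurve ℚ) W₁ ∧
        ∃ (K : Type) (_ : Field K) (_ : NumberField K), IsImaginaryQuadratic K ∧ NumberField.discr K ≤ -2495 ∧
          SatisfiesHeegnerHypothesis (W₁.conductorNorm ℤ) K ∧ SatisfiesHeegnerHypothesis 13 K ∧ Odd (NumberField.discr K) ∧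
          (W₁.quadraticTwist (NumberField.discr K : ℚ)).analyticRank = 1) := by
  haveI := EisensteinPrimesMazurMCOnCellBKernelCertP13ThirteenthCell.isElliptic_e13a22
  obtain ⟨W₁, U, Uc, iW₁, iW₁m, iU, iUm, iUc, iUcm, hWW₁, hpath, hUUc, q, hq, hv⟩ := h0
  have hEW₁ : IsIsogenous (⟨1, -1, 1, -7556512459866068, 256180460309112042534709⟩ : WeierstrassCurve ℚ) W₁ := hiso.trans' hWW₁
  rcases eq_or_firstStep_forward_of_not_into (not_twoStepAt_into_isogenous_e13a22 hmod W₁ hEW₁) hpath with hUW | ⟨B, hWB, -⟩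
  · subst hUW
    exact Or.inl ⟨Uc, iUc, iUcm, hEW₁.trans' hUUc, q, hq, hv⟩
  · obtain ⟨_, _, _, _, K, _, _, hK, hHN, hHp, hodd, hlt, hr1, -⟩ := hWB
    exact Or.inr ⟨W₁, iW₁, iW₁m, hEW₁, K, _, _, hK, EisensteinPrimesMazurMCOnCellBKernelCertP13DoorPriceClassII.discr_le_of_heegner_isogenous_e13a22 hmod W₁ hEW₁ K hK hHN hlt, hHN, hHp, hodd, hr1⟩

end Summit.BirchSwinnertonDyer.BirchSwinnertonDyer.Theorems.EisensteinPrimesMazurMCOnCellBKernelCertP13NoReverseEdgeV
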